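import Literature.Geometry.Lorentzian.KerrSchildDecayFine
import Literature.Geometry.Lorentzian.KerrDataAsymptoticFlatness
import HarnessLib

/-!
# The spin enters the second fundamental form of the Kerr–Schild slices only at order `ρ⁻³`

Continuation of `KerrSchildDecayFine.lean` / `KerrDataAsymptoticFlatness.lean`: the coordinate
expression of the second fundamental form `K_ν` of the slice `{t* = 0}`
(`Kerr.secondFundamentalForm_sliceEmbed_eq`:
`K_ν(v, w) = Gₛ(DN v, w̃) + ½ (DGₛ(v)(N, w̃) + DGₛ(N⃗)(w̃, ṽ) − DGₛ(w)(ṽ, N))`) for spin `a` differs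
from the same expression at spin `0` by a symbol of order `ρ⁻³` (every `k`): each term pairs a
difference `Gₐ − G₀ ∈ O_k(ρ⁻²)`, `D(Gₐ − G₀) ∈ O_k(ρ⁻³)`, `Nₐ − N₀ ∈ O_k(ρ⁻²)` or
`D(Nₐ − N₀) ∈ O_k(ρ⁻³)` with factors of order `0` or `ρ⁻²`. Consequently the chart components of the
tensor `k` of the spin-`a` Kerr data differ from those of the Schwarzschild (`a = 0`) Kerr–Schild data
— available in closed form, `Kerr.kRep` / `Kerr.data_k_zero_apply` — by `O_k(ρ⁻³)`
(`Kerr.isBigOSmooth_kCoeff_sub_zero`). This is the input for the ADM momentum of the Kerr data and for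
the failure of strong asymptotic flatness of Kerr–Schild slices. García-Parrado–Valiente Kroon,
J. Geom. Phys. 58 (2008), §5; Cook 2000, §3.2.2, (56)–(58). Everything is proved; no definitions,
no named facts.

## References

* A. García-Parrado, J. A. Valiente Kroon, *Kerr initial data*, J. Geom. Phys. 58 (2008), §5.
* G. B. Cook, *Initial data for numerical relativity*, Living Rev. Relativ. 3 (2000) 5, §3.2.2.
-/

noncomputable section

open Set Filter Asymptotics Bornology Topology Bundle TopologicalSpace Manifold
open scoped ContDiff RealInnerProductSpace Manifold

-- iterated operator-norm spaces over `E3`/`E4` (as in `KerrDataAsymptoticFlatness.lean`)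
set_option maxSynthPendingDepth 3
set_option synthInstance.maxHeartbeats 200000

namespace Literature.Geometry.Lorentzian

namespace Kerr

section Symbols

variable (M a : ℝ)

/-- `D(Gₐ − G₀) ∈ O_k(ρ⁻³)` along the slice. [cite: Cook2000, §3.2.2] -/
theorem isBigOSmooth_fderiv_bilin_sub_zero_ofTimeSpace (k : ℕ) :
    IsBigOSmooth k (-3) (fderiv ℝ fun z : E3 ↦
      bilin M a (E4.ofTimeSpace 0 z) - bilin M 0 (E4.ofTimeSpace 0 z)) := by
  have h := (isBigOSmooth_bilin_sub_zero_ofTimeSpace M a (k + 1)).fderiv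
  rw [show (-2 : ℝ) - 1 = -3 by norm_num] at h
  exact h

/-- `D(Nₐ − N₀) ∈ O_k(ρ⁻³)` along the slice. [cite: Cook2000, §3.2.2] -/
theorem isBigOSmooth_fderiv_sliceNormalRep_sub_zero_ofTimeSpace (k : ℕ) :
    IsBigOSmooth k (-3) (fderiv ℝ fun z : E3 ↦
      ((√(1 + 2 * scalarH M a (E4.ofTimeSpace 0 z)))⁻¹ • timeVector M a (E4.ofTimeSpace 0 z) -
        (√(1 + 2 * scalarH M 0 (E4.ofTimeSpace 0 z)))⁻¹ • timeVector M 0 (E4.ofTimeSpace 0 z))) := by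
  have h := (isBigOSmooth_sliceNormalRep_sub_zero_ofTimeSpace M a (k + 1)).fderiv
  rw [show (-2 : ℝ) - 1 = -3 by norm_num] at h
  exact h

/-- **The difference of the coordinate expressions of `K_ν` at spins `a` and `0`, written as a
combination of symbols, is `O_k(ρ⁻³)`.** (The eight products below are exactly the expansion of
`Formulaₐ − Formula₀` by bilinearity; see `isBigOSmooth_kCoeff_sub_zero` for the identification.)
García-Parrado–Valiente Kroon 2008, §5. [cite: Cook2000, §3.2.2 (57)] -/
theorem isBigOSmooth_secondFundamentalFormRep_sub_zero (k : ℕ) (v w : E3) :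
    IsBigOSmooth k (-3) fun z : E3 ↦
      ((bilin M a (E4.ofTimeSpace 0 z) - bilin M 0 (E4.ofTimeSpace 0 z))
          (fderiv ℝ (fun z : E3 ↦ (√(1 + 2 * scalarH M a (E4.ofTimeSpace 0 z)))⁻¹ •
            timeVector M a (E4.ofTimeSpace 0 z)) z v) (E4.ofTimeSpace 0 w) +
        bilin M 0 (E4.ofTimeSpace 0 z)
          (fderiv ℝ (fun z : E3 ↦
            ((√(1 + 2 * scalarH M a (E4.ofTimeSpace 0 z)))⁻¹ • timeVector M a (E4.ofTimeSpace 0 z) -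
              (√(1 + 2 * scalarH M 0 (E4.ofTimeSpace 0 z)))⁻¹ • timeVector M 0 (E4.ofTimeSpace 0 z)))
            z v) (E4.ofTimeSpace 0 w)) +
      2⁻¹ * ((fderiv ℝ (fun z : E3 ↦ bilin M a (E4.ofTimeSpace 0 z) - bilin M 0 (E4.ofTimeSpace 0 z)) z v
              ((√(1 + 2 * scalarH M a (E4.ofTimeSpace 0 z)))⁻¹ • timeVector M a (E4.ofTimeSpace 0 z))
              (E4.ofTimeSpace 0 w) +
            fderiv ℝ (fun z : E3 ↦ bilin M 0 (E4.ofTimeSpace 0 z)) z v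
              ((√(1 + 2 * scalarH M a (E4.ofTimeSpace 0 z)))⁻¹ • timeVector M a (E4.ofTimeSpace 0 z) -
                (√(1 + 2 * scalarH M 0 (E4.ofTimeSpace 0 z)))⁻¹ • timeVector M 0 (E4.ofTimeSpace 0 z))
              (E4.ofTimeSpace 0 w)) +
          (fderiv ℝ (fun z : E3 ↦ bilin M a (E4.ofTimeSpace 0 z) - bilin M 0 (E4.ofTimeSpace 0 z)) z
              (E4.spatial ((√(1 + 2 * scalarH M a (E4.ofTimeSpace 0 z)))⁻¹ •
                timeVector M a (E4.ofTimeSpace 0 z))) (E4.ofTimeSpace 0 w) (E4.ofTimeSpace 0 v) +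
            fderiv ℝ (fun z : E3 ↦ bilin M 0 (E4.ofTimeSpace 0 z)) z
              (E4.spatial ((√(1 + 2 * scalarH M a (E4.ofTimeSpace 0 z)))⁻¹ •
                  timeVector M a (E4.ofTimeSpace 0 z) -
                (√(1 + 2 * scalarH M 0 (E4.ofTimeSpace 0 z)))⁻¹ • timeVector M 0 (E4.ofTimeSpace 0 z)))
              (E4.ofTimeSpace 0 w) (E4.ofTimeSpace 0 v)) -
          (fderiv ℝ (fun z : E3 ↦ bilin M a (E4.ofTimeSpace 0 z) - bilin M 0 (E4.ofTimeSpace 0 z)) z w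
              (E4.ofTimeSpace 0 v)
              ((√(1 + 2 * scalarH M a (E4.ofTimeSpace 0 z)))⁻¹ • timeVector M a (E4.ofTimeSpace 0 z)) +
            fderiv ℝ (fun z : E3 ↦ bilin M 0 (E4.ofTimeSpace 0 z)) z w (E4.ofTimeSpace 0 v)
              ((√(1 + 2 * scalarH M a (E4.ofTimeSpace 0 z)))⁻¹ • timeVector M a (E4.ofTimeSpace 0 z) -
                (√(1 + 2 * scalarH M 0 (E4.ofTimeSpace 0 z)))⁻¹ • timeVector M 0 (E4.ofTimeSpace 0 z)))) := by
  have hΔG := isBigOSmooth_bilin_sub_zero_ofTimeSpace M a k          -- O_k(-2)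
  have hG0 := isBigOSmooth_bilin_ofTimeSpace M 0 k                    -- O_k(0)
  have hΔDG := isBigOSmooth_fderiv_bilin_sub_zero_ofTimeSpace M a k  -- O_k(-3)
  have hDG0 := isBigOSmooth_fderiv_bilin_ofTimeSpace M 0 k            -- O_k(-2)
  have hNa := isBigOSmooth_sliceNormalRep_ofTimeSpace M a k            -- O_k(0)
  have hΔN := isBigOSmooth_sliceNormalRep_sub_zero_ofTimeSpace M a k   -- O_k(-2)
  have hDNa := isBigOSmooth_fderiv_sliceNormalRep_ofTimeSpace M a k    -- O_k(-2)
  have hΔDN := isBigOSmooth_fderiv_sliceNormalRep_sub_zero_ofTimeSpace M a k  -- O_k(-3)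
  -- term A
  have hA₁ := (hΔG.clm_apply (hDNa.clm_apply_const v)).clm_apply_const (E4.ofTimeSpace 0 w)
  have hA₂ := (hG0.clm_apply (hΔDN.clm_apply_const v)).clm_apply_const (E4.ofTimeSpace 0 w)
  rw [show (-2 : ℝ) + -2 = -4 by norm_num] at hA₁
  rw [show (0 : ℝ) + -3 = -3 by norm_num] at hA₂
  have hA := (hA₁.mono (by norm_num : (-4 : ℝ) ≤ -3)).add hA₂
  -- term B₁
  have hB₁₁ := ((hΔDG.clm_apply_const v).clm_apply hNa).clm_apply_const (E4.ofTimeSpace 0 w)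
  have hB₁₂ := ((hDG0.clm_apply_const v).clm_apply hΔN).clm_apply_const (E4.ofTimeSpace 0 w)
  rw [show (-3 : ℝ) + 0 = -3 by norm_num] at hB₁₁
  rw [show (-2 : ℝ) + -2 = -4 by norm_num] at hB₁₂
  have hB₁ := hB₁₁.add (hB₁₂.mono (by norm_num : (-4 : ℝ) ≤ -3))
  -- term B₂
  have hB₂₁ := ((hΔDG.clm_apply (hNa.clm_comp_left E4.spatial)).clm_apply_const
    (E4.ofTimeSpace 0 w)).clm_apply_const (E4.ofTimeSpace 0 v)
  have hB₂₂ := ((hDG0.clm_apply (hΔN.clm_comp_left E4.spatial)).clm_apply_const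
    (E4.ofTimeSpace 0 w)).clm_apply_const (E4.ofTimeSpace 0 v)
  rw [show (-3 : ℝ) + 0 = -3 by norm_num] at hB₂₁
  rw [show (-2 : ℝ) + -2 = -4 by norm_num] at hB₂₂
  have hB₂ := hB₂₁.add (hB₂₂.mono (by norm_num : (-4 : ℝ) ≤ -3))
  -- term B₃
  have hB₃₁ := ((hΔDG.clm_apply_const w).clm_apply_const (E4.ofTimeSpace 0 v)).clm_apply hNa
  have hB₃₂ := ((hDG0.clm_apply_const w).clm_apply_const (E4.ofTimeSpace 0 v)).clm_apply hΔN
  rw [show (-3 : ℝ) + 0 = -3 by norm_num] at hB₃₁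
  rw [show (-2 : ℝ) + -2 = -4 by norm_num] at hB₃₂
  have hB₃ := hB₃₁.add (hB₃₂.mono (by norm_num : (-4 : ℝ) ≤ -3))
  exact (hA.add (((hB₁.add hB₂).sub hB₃).const_mul 2⁻¹)).congr fun z ↦ by
    simp only [map_sub, _root_.sub_apply]

end Symbols

/-! ### The chart components of `k`: spin `a` against spin `0` -/

section Coeff

variable [Facts] [SliceFacts]

/-- **The chart components of `k` for the Kerr data of spin `a` differ from those of the
Schwarzschild Kerr–Schild data by `O_k(ρ⁻³)`** (both read in the Kerr–Schild Cartesian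
coordinates of their ends `Kerr.afEnd a r₀`, `Kerr.afEnd 0 r₀`, which agree far out): beyond both
inner radii the components are the coordinate expressions `Formulaₐ`, `Formula₀`
(`kCoeff_afEnd_data_apply`, `secondFundamentalForm_sliceEmbed_eq`), whose difference expands by
bilinearity into `isBigOSmooth_secondFundamentalFormRep_sub_zero`. García-Parrado–Valiente Kroon
2008, §5 (the `a`-corrections to `k` are `O(r⁻³)`). [cite: Cook2000, §3.2.2 (57)] -/
theorem isBigOSmooth_kCoeff_sub_zero {M : ℝ} (hM : 0 ≤ M) (a r₀ : ℝ) (k : ℕ) :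
    IsBigOSmooth k (-3) fun z : E3 ↦
      AFEnd.kCoeff (afEnd a r₀) (data M a r₀ hM) z - AFEnd.kCoeff (afEnd 0 r₀) (data M 0 r₀ hM) z := by
  refine IsBigOSmooth.of_bilinForm_apply (EuclideanSpace.basisFun (Fin 3) ℝ) fun i j ↦ ?_
  set v : E3 := EuclideanSpace.basisFun (Fin 3) ℝ i with hv
  set w : E3 := EuclideanSpace.basisFun (Fin 3) ℝ j with hw
  obtain ⟨R₁, hR₁⟩ := exists_radius_of_eventually_cobounded (eventually_radius_ofTimeSpace_pos a)
  refine (isBigOSmooth_secondFundamentalFormRep_sub_zero M a k v w).congr_far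
    (R₁ := max (max (afRadius a r₀) (afRadius 0 r₀)) R₁) fun z hz ↦ ?_
  have hza : afRadius a r₀ < ‖z‖ := lt_of_le_of_lt ((le_max_left _ _).trans (le_max_left _ _)) hz
  have hz0' : afRadius 0 r₀ < ‖z‖ := lt_of_le_of_lt ((le_max_right _ _).trans (le_max_left _ _)) hz
  have hra : 0 < radius a (E4.ofTimeSpace 0 z) := hR₁ z (lt_of_le_of_lt (le_max_right _ _) hz)
  have hz0 : z ≠ 0 := norm_pos_iff.1 ((afRadius_pos a r₀).trans hza)
  have hr0 : 0 < radius 0 (E4.ofTimeSpace 0 z) := by rw [radius_zero_ofTimeSpace]; exact norm_pos_iff.2 hz0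
  -- differentiability of the building blocks at `z`
  have hO : ContDiff ℝ 1 (E4.ofTimeSpace 0) := contMDiff_iff_contDiff.mp (E4.contMDiff_ofTimeSpace 0 1)
  have hGa : DifferentiableAt ℝ (fun z : E3 ↦ bilin M a (E4.ofTimeSpace 0 z)) z :=
    ((contDiffAt_bilin M a hra (n := 1)).comp z hO.contDiffAt).differentiableAt one_ne_zero
  have hG0 : DifferentiableAt ℝ (fun z : E3 ↦ bilin M 0 (E4.ofTimeSpace 0 z)) z :=
    ((contDiffAt_bilin M 0 hr0 (n := 1)).comp z hO.contDiffAt).differentiableAt one_ne_zero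
  have hNa : DifferentiableAt ℝ (fun z : E3 ↦ (√(1 + 2 * scalarH M a (E4.ofTimeSpace 0 z)))⁻¹ •
      timeVector M a (E4.ofTimeSpace 0 z)) z :=
    (contDiffAt_sliceNormalRep hM a hra (n := 1)).differentiableAt one_ne_zero
  have hN0 : DifferentiableAt ℝ (fun z : E3 ↦ (√(1 + 2 * scalarH M 0 (E4.ofTimeSpace 0 z)))⁻¹ •
      timeVector M 0 (E4.ofTimeSpace 0 z)) z :=
    (contDiffAt_sliceNormalRep hM 0 hr0 (n := 1)).differentiableAt one_ne_zero
  conv_rhs => rw [_root_.sub_apply, _root_.sub_apply]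
  rw [kCoeff_afEnd_data_apply hM a r₀ hza, kCoeff_afEnd_data_apply hM 0 r₀ hz0', sliceK_apply, sliceK_apply,
    secondFundamentalForm_sliceEmbed_eq hM, secondFundamentalForm_sliceEmbed_eq hM,
    fderiv_fun_sub hGa hG0, fderiv_fun_sub hNa hN0]
  simp only [map_sub, _root_.sub_apply]
  ring

end Coeff

end Kerr

end Literature.Geometry.Lorentzian

end
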